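import Summits.BirchSwinnertonDyer.BirchSwinnertonDyer.Theorems.ByReductionTypeAtTwoFineSelmerConjAAtTwoAdditivePotGoodMuTwoKernelRowsC
import Summits.BirchSwinnertonDyer.BirchSwinnertonDyer.Theorems.ByReductionTypeAtTwoOrdKatoHalfAtTwoIsoConjATwoCubicModelOfClassicalMu
import HarnessLib

/-!
# Route `ByReductionTypeAtTwo` (rung K4), crux C1″ `FineSelmerConjAAtTwoAdditivePotGood` (item stmt-BirchSwinnertonDyer-22615):
# ASCENT STAMPS, part B (capitulation rows) — UNCONDITIONAL (A)₂ (ZERO hypotheses) for the census rows with TWO primes above `2` or EVEN `h`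
# and `Δ_cubic < 0`, by Iwasawa's `μ₂ = 0` (kernel certificates) + the `ℓ = 2` ascent to `ℚ(E[2])`
# (a `--supports 22615` file; seat `bsd-2adic-k4-w1` GEN 8, lane (c) of pen RC-472/481; consumer of cruxlead-19573-w2's p728213)

HONEST FRAMING (cell `bsd-2adic`, D-0036/D-0054/D-0152): THEOREMS ONLY (no definition, no named fact, no `sorry`). Each row theorem
`conjA_two_<L>'` is PROVED OUTRIGHT — statement (A) of Coates–Sujatha at `p = 2` for that ONE curve, with no hypothesis and no named
fact from print (the earlier stamps `conjA_two_<L> hLim2` needed Lim 2017 Thm. 3.5 at `2` DOWNSTAIRS at a real carrier). This is statement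
(A), NOT BSD: BSD₂ for these curves is not proved by any of this; C1″ (the `∀`-statement) stays research-open; nothing booked.

MECHANISM (all kernel): (1) `AddKatoTwo.classicalMu_two_<L>` (this seat's p728283/p728288/p728300): Iwasawa's `μ₂ = 0` along the cyclotomic
`ℤ₂`-extensions of the cubic point field `ℚ(θ)` (Chevalley door / capitulation certificate + `n₀ = 0` + Fukuda 1994 Thm. 1 (1); these cubic
fields have TWO primes above `2` or even `h`, outside Iwasawa 1956); (2) cruxlead-19573-w2 GEN 7's door
`TotallyComplexMu.conjA_two_cubicModel_of_classicalMu_of_discr_neg` (p728213): `Δ_cubic < 0` ⟹ `ℚ(θ)` has one real place (k4-w1 p724162) and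
`ℚ(E[2]) = ℚ(θ)(e₂ − e₃)` is totally complex; Iwasawa's `ℓ = 2` ascent with real places (p726686/p727411, unit signatures of the layers
from `ℚ_n`) carries `μ₂ = 0` up to `ℚ(E[2])`; the guarded KERNEL Lim 3.5@2 (p723148) gives (A)₂. The reduced presentation `θ` and
`ℚ(P) = ℚ(β) = ℚ(θ)` are GEN 5–7's; irreducibility of the `2`-division cubic from `[ℚ(β) : ℚ] = 3` (`irreducible_cubic_of_finrank_adjoin_eq_three`, public in part A; private copy here so both parts verify independently).
Rows here: `194140b1` (d = -2284) · `98592q1` (d = -4108) · `433336a1` (d = -54167) · `294104f1` (d = -36763) · `121440bf1` (d = -10120) · `460944bn1` (d = -115236).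

References: [CoatesSujatha2005] Conj. A, Thm. 3.4; [Iwasawa1973MuInvariants] Thm. 2/3; [Fukuda1994] Thm. 1 (1); [Lim2017FineSelmer] §3;
tree p723148, p726686, p727411, p728213 (w2), p724162, p728283, p728288, p728300 (k4-w1).
-/

set_option autoImplicit false
-- sibling precedent (`…GenusDoorCubic.lean`): the directory name repeats the summit name
set_option linter.dupNamespace false

noncomputable section

open scoped Classical IntermediateField NumberField

namespace Summit.BirchSwinnertonDyer.BirchSwinnertonDyer.Theorems.AddKatoTwo

open WeierstrassCurve Field Polynomial IsDedekindDomain NumberField Matrix Literature.NumberTheory.EllipticCurves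
  Literature.NumberTheory.GaloisRepresentations
  Literature.NumberTheory.IwasawaTheory
  Summit.BirchSwinnertonDyer.BirchSwinnertonDyer.Theorems.SteinbergFibreAtTwo
  Summit.BirchSwinnertonDyer.BirchSwinnertonDyer.Theorems.AlignedTransportAtTwoTorsionPointField
  Summit.BirchSwinnertonDyer.BirchSwinnertonDyer.Theses.ByReductionTypeAtTwo

/-- **A monic integer cubic with a root `β` of degree `3` is irreducible** (`[ℚ(β) : ℚ] = 3` ⟹ the cubic is the minimal polynomial of `β`).
[folklore] -/
private theorem irreducible_cubic_of_finrank_adjoin_eq_three {p q r : ℤ} {β : AlgebraicClosure ℚ}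
    (hβ : aeval β (Cubic.toPoly ⟨1, (p : ℚ), q, r⟩) = 0) (h3 : Module.finrank ℚ (IntermediateField.adjoin ℚ {β}) = 3) :
    Irreducible (Cubic.toPoly ⟨1, (p : ℚ), q, r⟩) := by
  have hfm : (Cubic.toPoly ⟨1, (p : ℚ), q, r⟩).Monic := Cubic.monic_of_a_eq_one'
  have hβint : IsIntegral ℚ β := ⟨_, hfm, by rwa [← aeval_def]⟩
  have hdeg : (minpoly ℚ β).natDegree = (Cubic.toPoly ⟨1, (p : ℚ), q, r⟩).natDegree := by
    rw [← IntermediateField.adjoin.finrank hβint, h3, Cubic.natDegree_of_a_ne_zero' one_ne_zero]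
  have heq : Cubic.toPoly ⟨1, (p : ℚ), q, r⟩ = minpoly ℚ β :=
    Polynomial.eq_of_monic_of_dvd_of_natDegree_le (minpoly.monic hβint) hfm (minpoly.dvd ℚ β hβ) hdeg.ge
  rw [heq]
  exact minpoly.irreducible hβint

/-- **UNCONDITIONAL (A)₂ for the census curve `194140b1` — ZERO hypotheses, ZERO named facts** (capitulation row; `2`-torsion cubic field
`ℚ(θ)`, `θ³ + (-2)θ² + (-16)θ + (-18) = 0`, `d = -2284` < 0, TWO primes above `2` or even `h`). Coates–Sujatha's statement (A) at `p = 2`: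
for every cyclotomic `ℤ₂`-extension of `ℚ` the dual fine Selmer group over `ℚ_∞` is finitely generated over `ℤ₂` (`∃ γ D` currency). KERNEL:
`classicalMu_two_194140b1` (μ₂(ℚ(θ)_cyc) = 0, GEN 5–7 certificates + Fukuda) ⟹ cruxlead-19573-w2's ℓ = 2 ascent to the totally complex
`ℚ(E[2]) = ℚ(θ, √disc)` and guarded kernel Lim 3.5@2 (`TotallyComplexMu.conjA_two_cubicModel_of_classicalMu_of_discr_neg`, p728213).
UPGRADES `conjA_two_194140b1 hLim2`. BSD for `194140b1` is NOT proved by this. [cite: CoatesSujatha2005, Conj. A and Thm. 3.4]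
[cite: Iwasawa1973MuInvariants, Thm. 2 and Thm. 3] [cite: Fukuda1994, Thm. 1 (1), p. 264] -/
theorem conjA_two_194140b1' (κ : ZpExtension ℚ 2) (hκ : κ.IsCyclotomic) :
    haveI := isElliptic_194140b1'
    ∃ (γ : absoluteGaloisGroup ℚ) (D : (⟨0, ((-1 : ℤ) : ℚ), 0, ((-3712423301 : ℤ) : ℚ), ((-87062743809199 : ℤ) : ℚ)⟩ : WeierstrassCurve ℚ).FineSelmerDualData κ γ),
      Module.Finite ℤ_[2] (RestrictScalars ℤ_[2] (IwasawaAlgebra 2) D.X) := by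
  haveI := isElliptic_194140b1'
  obtain ⟨θ, hθ⟩ : ∃ θ : AlgebraicClosure ℚ, aeval θ (Cubic.toPoly ⟨1, ((-2 : ℤ) : ℚ), ((-16 : ℤ) : ℚ), ((-18 : ℤ) : ℚ)⟩) = 0 :=
    IsAlgClosed.exists_aeval_eq_zero _ _ (by rw [Cubic.degree_of_a_ne_zero one_ne_zero]; norm_num)
  have hθ' : θ ^ 3 + (-2 : AlgebraicClosure ℚ) * θ ^ 2 + (-16 : AlgebraicClosure ℚ) * θ + (-18 : AlgebraicClosure ℚ) = 0 := by
    have := hθ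
    simp only [Cubic.toPoly, map_one, one_mul, aeval_add, aeval_mul, aeval_C, aeval_X_pow, aeval_X,
      eq_ratCast, Rat.cast_intCast] at this
    push_cast at this
    linear_combination this
  set β : AlgebraicClosure ℚ := algebraMap ℚ (AlgebraicClosure ℚ) (-28385 : ℚ) +
      algebraMap ℚ (AlgebraicClosure ℚ) (7100 : ℚ) * θ + algebraMap ℚ (AlgebraicClosure ℚ) (1971 : ℚ) * θ ^ 2 with hβdef
  have hβ : aeval β (Cubic.toPoly ⟨1, ((-1 : ℤ) : ℚ), ((-3712423301 : ℤ) : ℚ), ((-87062743809199 : ℤ) : ℚ)⟩) = 0 := by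
    simp only [Cubic.toPoly, map_one, one_mul, aeval_add, aeval_mul, aeval_C, aeval_X_pow, aeval_X, eq_ratCast,
      Rat.cast_intCast]
    rw [hβdef]
    simp only [eq_ratCast]
    push_cast
    linear_combination ((253135671398 : AlgebraicClosure ℚ) + (285891468624 : AlgebraicClosure ℚ) * θ + (98061156522 : AlgebraicClosure ℚ) * θ ^ 2 + (7657021611 : AlgebraicClosure ℚ) * θ ^ 3) * hθ'
  have hadj : IntermediateField.adjoin ℚ {β} = IntermediateField.adjoin ℚ {θ} := by
    apply le_antisymm
    · rw [IntermediateField.adjoin_simple_le_iff, hβdef]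
      have hθmem := IntermediateField.mem_adjoin_simple_self ℚ θ
      exact add_mem (add_mem (algebraMap_mem _ _) (mul_mem (algebraMap_mem _ _) hθmem))
        (mul_mem (algebraMap_mem _ _) (pow_mem hθmem 2))
    · rw [IntermediateField.adjoin_simple_le_iff]
      have hθeq : θ = algebraMap ℚ (AlgebraicClosure ℚ) (4905769425821/41503906250 : ℚ) +
          algebraMap ℚ (AlgebraicClosure ℚ) (1443791/830078125 : ℚ) * β +
          algebraMap ℚ (AlgebraicClosure ℚ) (-1971/41503906250 : ℚ) * β ^ 2 := by
        rw [hβdef]; simp only [eq_ratCast]; push_cast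
        linear_combination (((35239392711 : AlgebraicClosure ℚ) / 20751953125) + ((7657021611 : AlgebraicClosure ℚ) / 41503906250) * θ) * hθ'
      rw [hθeq]
      have hβmem := IntermediateField.mem_adjoin_simple_self ℚ β
      exact add_mem (add_mem (algebraMap_mem _ _) (mul_mem (algebraMap_mem _ _) hβmem))
        (mul_mem (algebraMap_mem _ _) (pow_mem hβmem 2))
  have h3 : Module.finrank ℚ (IntermediateField.adjoin ℚ {β}) = 3 := by
    rw [hadj]; exact finrank_adjoin_eq_three_of_irreducible irreducible_cubic_d2284n hθ
  exact TotallyComplexMu.conjA_two_cubicModel_of_classicalMu_of_discr_neg (-1) (-3712423301) (-87062743809199)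
    (irreducible_cubic_of_finrank_adjoin_eq_three hβ h3) (by simp only [Cubic.discr]; norm_num) hβ
    (by rw [hadj]; exact classicalMu_two_194140b1 hθ) κ hκ

/-- **UNCONDITIONAL (A)₂ for the census curve `98592q1` — ZERO hypotheses, ZERO named facts** (capitulation row; `2`-torsion cubic field
`ℚ(θ)`, `θ³ + (0)θ² + (10)θ + (-2) = 0`, `d = -4108` < 0, TWO primes above `2` or even `h`). Coates–Sujatha's statement (A) at `p = 2`:
for every cyclotomic `ℤ₂`-extension of `ℚ` the dual fine Selmer group over `ℚ_∞` is finitely generated over `ℤ₂` (`∃ γ D` currency). KERNEL: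
`classicalMu_two_98592q1` (μ₂(ℚ(θ)_cyc) = 0, GEN 5–7 certificates + Fukuda) ⟹ cruxlead-19573-w2's ℓ = 2 ascent to the totally complex
`ℚ(E[2]) = ℚ(θ, √disc)` and guarded kernel Lim 3.5@2 (`TotallyComplexMu.conjA_two_cubicModel_of_classicalMu_of_discr_neg`, p728213).
UPGRADES `conjA_two_98592q1 hLim2`. BSD for `98592q1` is NOT proved by this. [cite: CoatesSujatha2005, Conj. A and Thm. 3.4]
[cite: Iwasawa1973MuInvariants, Thm. 2 and Thm. 3] [cite: Fukuda1994, Thm. 1 (1), p. 264] -/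
theorem conjA_two_98592q1' (κ : ZpExtension ℚ 2) (hκ : κ.IsCyclotomic) :
    haveI := isElliptic_98592q1'
    ∃ (γ : absoluteGaloisGroup ℚ) (D : (⟨0, ((-1 : ℤ) : ℚ), 0, ((-195347181 : ℤ) : ℚ), ((-1770320388987 : ℤ) : ℚ)⟩ : WeierstrassCurve ℚ).FineSelmerDualData κ γ),
      Module.Finite ℤ_[2] (RestrictScalars ℤ_[2] (IwasawaAlgebra 2) D.X) := by
  haveI := isElliptic_98592q1'
  obtain ⟨θ, hθ⟩ : ∃ θ : AlgebraicClosure ℚ, aeval θ (Cubic.toPoly ⟨1, ((0 : ℤ) : ℚ), ((10 : ℤ) : ℚ), ((-2 : ℤ) : ℚ)⟩) = 0 :=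
    IsAlgClosed.exists_aeval_eq_zero _ _ (by rw [Cubic.degree_of_a_ne_zero one_ne_zero]; norm_num)
  have hθ' : θ ^ 3 + (0 : AlgebraicClosure ℚ) * θ ^ 2 + (10 : AlgebraicClosure ℚ) * θ + (-2 : AlgebraicClosure ℚ) = 0 := by
    have := hθ
    simp only [Cubic.toPoly, map_one, one_mul, aeval_add, aeval_mul, aeval_C, aeval_X_pow, aeval_X,
      eq_ratCast, Rat.cast_intCast] at this
    push_cast at this
    linear_combination this
  set β : AlgebraicClosure ℚ := algebraMap ℚ (AlgebraicClosure ℚ) (17387 : ℚ) +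
      algebraMap ℚ (AlgebraicClosure ℚ) (-1154 : ℚ) * θ + algebraMap ℚ (AlgebraicClosure ℚ) (2608 : ℚ) * θ ^ 2 with hβdef
  have hβ : aeval β (Cubic.toPoly ⟨1, ((-1 : ℤ) : ℚ), ((-195347181 : ℤ) : ℚ), ((-1770320388987 : ℤ) : ℚ)⟩) = 0 := by
    simp only [Cubic.toPoly, map_one, one_mul, aeval_add, aeval_mul, aeval_C, aeval_X_pow, aeval_X, eq_ratCast,
      Rat.cast_intCast]
    rw [hβdef]
    simp only [eq_ratCast]
    push_cast
    linear_combination ((-44550523400 : AlgebraicClosure ℚ) + (187806743104 : AlgebraicClosure ℚ) * θ + (-23547360768 : AlgebraicClosure ℚ) * θ ^ 2 + (17738739712 : AlgebraicClosure ℚ) * θ ^ 3) * hθ'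
  have hadj : IntermediateField.adjoin ℚ {β} = IntermediateField.adjoin ℚ {θ} := by
    apply le_antisymm
    · rw [IntermediateField.adjoin_simple_le_iff, hβdef]
      have hθmem := IntermediateField.mem_adjoin_simple_self ℚ θ
      exact add_mem (add_mem (algebraMap_mem _ _) (mul_mem (algebraMap_mem _ _) hθmem))
        (mul_mem (algebraMap_mem _ _) (pow_mem hθmem 2))
    · rw [IntermediateField.adjoin_simple_le_iff]
      have hθeq : θ = algebraMap ℚ (AlgebraicClosure ℚ) (-28302969251/9625456854 : ℚ) +
          algebraMap ℚ (AlgebraicClosure ℚ) (-6001417/28876370562 : ℚ) * β +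
          algebraMap ℚ (AlgebraicClosure ℚ) (326/14438185281 : ℚ) * β ^ 2 := by
        rw [hβdef]; simp only [eq_ratCast]; push_cast
        linear_combination (((1962280064 : AlgebraicClosure ℚ) / 14438185281) + ((-2217342464 : AlgebraicClosure ℚ) / 14438185281) * θ) * hθ'
      rw [hθeq]
      have hβmem := IntermediateField.mem_adjoin_simple_self ℚ β
      exact add_mem (add_mem (algebraMap_mem _ _) (mul_mem (algebraMap_mem _ _) hβmem))
        (mul_mem (algebraMap_mem _ _) (pow_mem hβmem 2))
  have h3 : Module.finrank ℚ (IntermediateField.adjoin ℚ {β}) = 3 := by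
    rw [hadj]; exact finrank_adjoin_eq_three_of_irreducible irreducible_cubic_d4108n hθ
  exact TotallyComplexMu.conjA_two_cubicModel_of_classicalMu_of_discr_neg (-1) (-195347181) (-1770320388987)
    (irreducible_cubic_of_finrank_adjoin_eq_three hβ h3) (by simp only [Cubic.discr]; norm_num) hβ
    (by rw [hadj]; exact classicalMu_two_98592q1 hθ) κ hκ

/-- **UNCONDITIONAL (A)₂ for the census curve `433336a1` — ZERO hypotheses, ZERO named facts** (capitulation row; `2`-torsion cubic field
`ℚ(θ)`, `θ³ + (-1)θ² + (-38)θ + (-89) = 0`, `d = -54167` < 0, TWO primes above `2` or even `h`). Coates–Sujatha's statement (A) at `p = 2`: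
for every cyclotomic `ℤ₂`-extension of `ℚ` the dual fine Selmer group over `ℚ_∞` is finitely generated over `ℤ₂` (`∃ γ D` currency). KERNEL:
`classicalMu_two_433336a1` (μ₂(ℚ(θ)_cyc) = 0, GEN 5–7 certificates + Fukuda) ⟹ cruxlead-19573-w2's ℓ = 2 ascent to the totally complex
`ℚ(E[2]) = ℚ(θ, √disc)` and guarded kernel Lim 3.5@2 (`TotallyComplexMu.conjA_two_cubicModel_of_classicalMu_of_discr_neg`, p728213).
UPGRADES `conjA_two_433336a1 hLim2`. BSD for `433336a1` is NOT proved by this. [cite: CoatesSujatha2005, Conj. A and Thm. 3.4]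
[cite: Iwasawa1973MuInvariants, Thm. 2 and Thm. 3] [cite: Fukuda1994, Thm. 1 (1), p. 264] -/
theorem conjA_two_433336a1' (κ : ZpExtension ℚ 2) (hκ : κ.IsCyclotomic) :
    haveI := isElliptic_433336a1'
    ∃ (γ : absoluteGaloisGroup ℚ) (D : (⟨0, ((0 : ℤ) : ℚ), 0, ((-230659 : ℤ) : ℚ), ((-42638677 : ℤ) : ℚ)⟩ : WeierstrassCurve ℚ).FineSelmerDualData κ γ),
      Module.Finite ℤ_[2] (RestrictScalars ℤ_[2] (IwasawaAlgebra 2) D.X) := by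
  haveI := isElliptic_433336a1'
  obtain ⟨θ, hθ⟩ : ∃ θ : AlgebraicClosure ℚ, aeval θ (Cubic.toPoly ⟨1, ((-1 : ℤ) : ℚ), ((-38 : ℤ) : ℚ), ((-89 : ℤ) : ℚ)⟩) = 0 :=
    IsAlgClosed.exists_aeval_eq_zero _ _ (by rw [Cubic.degree_of_a_ne_zero one_ne_zero]; norm_num)
  have hθ' : θ ^ 3 + (-1 : AlgebraicClosure ℚ) * θ ^ 2 + (-38 : AlgebraicClosure ℚ) * θ + (-89 : AlgebraicClosure ℚ) = 0 := by
    have := hθ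
    simp only [Cubic.toPoly, map_one, one_mul, aeval_add, aeval_mul, aeval_C, aeval_X_pow, aeval_X,
      eq_ratCast, Rat.cast_intCast] at this
    push_cast at this
    linear_combination this
  set β : AlgebraicClosure ℚ := algebraMap ℚ (AlgebraicClosure ℚ) (-195 : ℚ) +
      algebraMap ℚ (AlgebraicClosure ℚ) (46 : ℚ) * θ + algebraMap ℚ (AlgebraicClosure ℚ) (7 : ℚ) * θ ^ 2 with hβdef
  have hβ : aeval β (Cubic.toPoly ⟨1, ((0 : ℤ) : ℚ), ((-230659 : ℤ) : ℚ), ((-42638677 : ℤ) : ℚ)⟩) = 0 := by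
    simp only [Cubic.toPoly, map_one, one_mul, aeval_add, aeval_mul, aeval_C, aeval_X_pow, aeval_X, eq_ratCast,
      Rat.cast_intCast]
    rw [hβdef]
    simp only [eq_ratCast]
    push_cast
    linear_combination ((57023 : AlgebraicClosure ℚ) + (35910 : AlgebraicClosure ℚ) * θ + (7105 : AlgebraicClosure ℚ) * θ ^ 2 + (343 : AlgebraicClosure ℚ) * θ ^ 3) * hθ'
  have hadj : IntermediateField.adjoin ℚ {β} = IntermediateField.adjoin ℚ {θ} := by
    apply le_antisymm
    · rw [IntermediateField.adjoin_simple_le_iff, hβdef]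
      have hθmem := IntermediateField.mem_adjoin_simple_self ℚ θ
      exact add_mem (add_mem (algebraMap_mem _ _) (mul_mem (algebraMap_mem _ _) hθmem))
        (mul_mem (algebraMap_mem _ _) (pow_mem hθmem 2))
    · rw [IntermediateField.adjoin_simple_le_iff]
      have hθeq : θ = algebraMap ℚ (AlgebraicClosure ℚ) (1076409 : ℚ) +
          algebraMap ℚ (AlgebraicClosure ℚ) (1941 : ℚ) * β +
          algebraMap ℚ (AlgebraicClosure ℚ) (-7 : ℚ) * β ^ 2 := by
        rw [hβdef]; simp only [eq_ratCast]; push_cast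
        linear_combination ((4851 : AlgebraicClosure ℚ) + (343 : AlgebraicClosure ℚ) * θ) * hθ'
      rw [hθeq]
      have hβmem := IntermediateField.mem_adjoin_simple_self ℚ β
      exact add_mem (add_mem (algebraMap_mem _ _) (mul_mem (algebraMap_mem _ _) hβmem))
        (mul_mem (algebraMap_mem _ _) (pow_mem hβmem 2))
  have h3 : Module.finrank ℚ (IntermediateField.adjoin ℚ {β}) = 3 := by
    rw [hadj]; exact finrank_adjoin_eq_three_of_irreducible irreducible_cubic_d54167n hθ
  exact TotallyComplexMu.conjA_two_cubicModel_of_classicalMu_of_discr_neg (0) (-230659) (-42638677)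
    (irreducible_cubic_of_finrank_adjoin_eq_three hβ h3) (by simp only [Cubic.discr]; norm_num) hβ
    (by rw [hadj]; exact classicalMu_two_433336a1 hθ) κ hκ

/-- **UNCONDITIONAL (A)₂ for the census curve `294104f1` — ZERO hypotheses, ZERO named facts** (capitulation row; `2`-torsion cubic field
`ℚ(θ)`, `θ³ + (-1)θ² + (-59)θ + (-160) = 0`, `d = -36763` < 0, TWO primes above `2` or even `h`). Coates–Sujatha's statement (A) at `p = 2`:
for every cyclotomic `ℤ₂`-extension of `ℚ` the dual fine Selmer group over `ℚ_∞` is finitely generated over `ℤ₂` (`∃ γ D` currency). KERNEL: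
`classicalMu_two_294104f1` (μ₂(ℚ(θ)_cyc) = 0, GEN 5–7 certificates + Fukuda) ⟹ cruxlead-19573-w2's ℓ = 2 ascent to the totally complex
`ℚ(E[2]) = ℚ(θ, √disc)` and guarded kernel Lim 3.5@2 (`TotallyComplexMu.conjA_two_cubicModel_of_classicalMu_of_discr_neg`, p728213).
UPGRADES `conjA_two_294104f1 hLim2`. BSD for `294104f1` is NOT proved by this. [cite: CoatesSujatha2005, Conj. A and Thm. 3.4]
[cite: Iwasawa1973MuInvariants, Thm. 2 and Thm. 3] [cite: Fukuda1994, Thm. 1 (1), p. 264] -/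
theorem conjA_two_294104f1' (κ : ZpExtension ℚ 2) (hκ : κ.IsCyclotomic) :
    haveI := isElliptic_294104f1'
    ∃ (γ : absoluteGaloisGroup ℚ) (D : (⟨0, ((-1 : ℤ) : ℚ), 0, ((63420977 : ℤ) : ℚ), ((13288243896 : ℤ) : ℚ)⟩ : WeierstrassCurve ℚ).FineSelmerDualData κ γ),
      Module.Finite ℤ_[2] (RestrictScalars ℤ_[2] (IwasawaAlgebra 2) D.X) := by
  haveI := isElliptic_294104f1'
  obtain ⟨θ, hθ⟩ : ∃ θ : AlgebraicClosure ℚ, aeval θ (Cubic.toPoly ⟨1, ((-1 : ℤ) : ℚ), ((-59 : ℤ) : ℚ), ((-160 : ℤ) : ℚ)⟩) = 0 :=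
    IsAlgClosed.exists_aeval_eq_zero _ _ (by rw [Cubic.degree_of_a_ne_zero one_ne_zero]; norm_num)
  have hθ' : θ ^ 3 + (-1 : AlgebraicClosure ℚ) * θ ^ 2 + (-59 : AlgebraicClosure ℚ) * θ + (-160 : AlgebraicClosure ℚ) = 0 := by
    have := hθ
    simp only [Cubic.toPoly, map_one, one_mul, aeval_add, aeval_mul, aeval_C, aeval_X_pow, aeval_X,
      eq_ratCast, Rat.cast_intCast] at this
    push_cast at this
    linear_combination this
  set β : AlgebraicClosure ℚ := algebraMap ℚ (AlgebraicClosure ℚ) (42248 : ℚ) +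
      algebraMap ℚ (AlgebraicClosure ℚ) (5704 : ℚ) * θ + algebraMap ℚ (AlgebraicClosure ℚ) (-1113 : ℚ) * θ ^ 2 with hβdef
  have hβ : aeval β (Cubic.toPoly ⟨1, ((-1 : ℤ) : ℚ), ((63420977 : ℤ) : ℚ), ((13288243896 : ℤ) : ℚ)⟩) = 0 := by
    simp only [Cubic.toPoly, map_one, one_mul, aeval_add, aeval_mul, aeval_C, aeval_X_pow, aeval_X, eq_ratCast,
      Rat.cast_intCast]
    rw [hβdef]
    simp only [eq_ratCast]
    push_cast
    linear_combination ((-488119334648 : AlgebraicClosure ℚ) + (-13158301149 : AlgebraicClosure ℚ) * θ + (19819065231 : AlgebraicClosure ℚ) * θ ^ 2 + (-1378749897 : AlgebraicClosure ℚ) * θ ^ 3) * hθ'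
  have hadj : IntermediateField.adjoin ℚ {β} = IntermediateField.adjoin ℚ {θ} := by
    apply le_antisymm
    · rw [IntermediateField.adjoin_simple_le_iff, hβdef]
      have hθmem := IntermediateField.mem_adjoin_simple_self ℚ θ
      exact add_mem (add_mem (algebraMap_mem _ _) (mul_mem (algebraMap_mem _ _) hθmem))
        (mul_mem (algebraMap_mem _ _) (pow_mem hθmem 2))
    · rw [IntermediateField.adjoin_simple_le_iff]
      have hθeq : θ = algebraMap ℚ (AlgebraicClosure ℚ) (48818549056/5280674083 : ℚ) +
          algebraMap ℚ (AlgebraicClosure ℚ) (120604/5280674083 : ℚ) * β +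
          algebraMap ℚ (AlgebraicClosure ℚ) (1113/5280674083 : ℚ) * β ^ 2 := by
        rw [hβdef]; simp only [eq_ratCast]; push_cast
        linear_combination (((12753126855 : AlgebraicClosure ℚ) / 5280674083) + ((-1378749897 : AlgebraicClosure ℚ) / 5280674083) * θ) * hθ'
      rw [hθeq]
      have hβmem := IntermediateField.mem_adjoin_simple_self ℚ β
      exact add_mem (add_mem (algebraMap_mem _ _) (mul_mem (algebraMap_mem _ _) hβmem))
        (mul_mem (algebraMap_mem _ _) (pow_mem hβmem 2))
  have h3 : Module.finrank ℚ (IntermediateField.adjoin ℚ {β}) = 3 := by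
    rw [hadj]; exact finrank_adjoin_eq_three_of_irreducible irreducible_cubic_d36763n hθ
  exact TotallyComplexMu.conjA_two_cubicModel_of_classicalMu_of_discr_neg (-1) (63420977) (13288243896)
    (irreducible_cubic_of_finrank_adjoin_eq_three hβ h3) (by simp only [Cubic.discr]; norm_num) hβ
    (by rw [hadj]; exact classicalMu_two_294104f1 hθ) κ hκ

/-- **UNCONDITIONAL (A)₂ for the census curve `121440bf1` — ZERO hypotheses, ZERO named facts** (capitulation row; `2`-torsion cubic field
`ℚ(θ)`, `θ³ + (-3)θ² + (10)θ + (10) = 0`, `d = -10120` < 0, TWO primes above `2` or even `h`). Coates–Sujatha's statement (A) at `p = 2`: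
for every cyclotomic `ℤ₂`-extension of `ℚ` the dual fine Selmer group over `ℚ_∞` is finitely generated over `ℤ₂` (`∃ γ D` currency). KERNEL:
`classicalMu_two_121440bf1` (μ₂(ℚ(θ)_cyc) = 0, GEN 5–7 certificates + Fukuda) ⟹ cruxlead-19573-w2's ℓ = 2 ascent to the totally complex
`ℚ(E[2]) = ℚ(θ, √disc)` and guarded kernel Lim 3.5@2 (`TotallyComplexMu.conjA_two_cubicModel_of_classicalMu_of_discr_neg`, p728213).
UPGRADES `conjA_two_121440bf1 hLim2`. BSD for `121440bf1` is NOT proved by this. [cite: CoatesSujatha2005, Conj. A and Thm. 3.4]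
[cite: Iwasawa1973MuInvariants, Thm. 2 and Thm. 3] [cite: Fukuda1994, Thm. 1 (1), p. 264] -/
theorem conjA_two_121440bf1' (κ : ZpExtension ℚ 2) (hκ : κ.IsCyclotomic) :
    haveI := isElliptic_121440bf1'
    ∃ (γ : absoluteGaloisGroup ℚ) (D : (⟨0, ((-1 : ℤ) : ℚ), 0, ((-3251092416 : ℤ) : ℚ), ((-71348605585884 : ℤ) : ℚ)⟩ : WeierstrassCurve ℚ).FineSelmerDualData κ γ),
      Module.Finite ℤ_[2] (RestrictScalars ℤ_[2] (IwasawaAlgebra 2) D.X) := by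
  haveI := isElliptic_121440bf1'
  obtain ⟨θ, hθ⟩ : ∃ θ : AlgebraicClosure ℚ, aeval θ (Cubic.toPoly ⟨1, ((-3 : ℤ) : ℚ), ((10 : ℤ) : ℚ), ((10 : ℤ) : ℚ)⟩) = 0 :=
    IsAlgClosed.exists_aeval_eq_zero _ _ (by rw [Cubic.degree_of_a_ne_zero one_ne_zero]; norm_num)
  have hθ' : θ ^ 3 + (-3 : AlgebraicClosure ℚ) * θ ^ 2 + (10 : AlgebraicClosure ℚ) * θ + (10 : AlgebraicClosure ℚ) = 0 := by
    have := hθ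
    simp only [Cubic.toPoly, map_one, one_mul, aeval_add, aeval_mul, aeval_C, aeval_X_pow, aeval_X,
      eq_ratCast, Rat.cast_intCast] at this
    push_cast at this
    linear_combination this
  set β : AlgebraicClosure ℚ := algebraMap ℚ (AlgebraicClosure ℚ) (44696 : ℚ) +
      algebraMap ℚ (AlgebraicClosure ℚ) (-22670 : ℚ) * θ + algebraMap ℚ (AlgebraicClosure ℚ) (6007 : ℚ) * θ ^ 2 with hβdef
  have hβ : aeval β (Cubic.toPoly ⟨1, ((-1 : ℤ) : ℚ), ((-3251092416 : ℤ) : ℚ), ((-71348605585884 : ℤ) : ℚ)⟩) = 0 := by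
    simp only [Cubic.toPoly, map_one, one_mul, aeval_add, aeval_mul, aeval_C, aeval_X_pow, aeval_X, eq_ratCast,
      Rat.cast_intCast]
    rw [hβdef]
    simp only [eq_ratCast]
    push_cast
    linear_combination ((-12737078187830 : AlgebraicClosure ℚ) + (6520929185350 : AlgebraicClosure ℚ) * θ + (-1803805525461 : AlgebraicClosure ℚ) * θ ^ 2 + (216756882343 : AlgebraicClosure ℚ) * θ ^ 3) * hθ'
  have hadj : IntermediateField.adjoin ℚ {β} = IntermediateField.adjoin ℚ {θ} := by
    apply le_antisymm
    · rw [IntermediateField.adjoin_simple_le_iff, hβdef]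
      have hθmem := IntermediateField.mem_adjoin_simple_self ℚ θ
      exact add_mem (add_mem (algebraMap_mem _ _) (mul_mem (algebraMap_mem _ _) hθmem))
        (mul_mem (algebraMap_mem _ _) (pow_mem hθmem 2))
    · rw [IntermediateField.adjoin_simple_le_iff]
      have hθeq : θ = algebraMap ℚ (AlgebraicClosure ℚ) (197265539887/759375 : ℚ) +
          algebraMap ℚ (AlgebraicClosure ℚ) (39550091/10023750 : ℚ) * β +
          algebraMap ℚ (AlgebraicClosure ℚ) (-6007/50118750 : ℚ) * β ^ 2 := by
        rw [hβdef]; simp only [eq_ratCast]; push_cast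
        linear_combination (((-985780134631 : AlgebraicClosure ℚ) / 50118750) + ((216756882343 : AlgebraicClosure ℚ) / 50118750) * θ) * hθ'
      rw [hθeq]
      have hβmem := IntermediateField.mem_adjoin_simple_self ℚ β
      exact add_mem (add_mem (algebraMap_mem _ _) (mul_mem (algebraMap_mem _ _) hβmem))
        (mul_mem (algebraMap_mem _ _) (pow_mem hβmem 2))
  have h3 : Module.finrank ℚ (IntermediateField.adjoin ℚ {β}) = 3 := by
    rw [hadj]; exact finrank_adjoin_eq_three_of_irreducible irreducible_cubic_d10120n hθ
  exact TotallyComplexMu.conjA_two_cubicModel_of_classicalMu_of_discr_neg (-1) (-3251092416) (-71348605585884)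
    (irreducible_cubic_of_finrank_adjoin_eq_three hβ h3) (by simp only [Cubic.discr]; norm_num) hβ
    (by rw [hadj]; exact classicalMu_two_121440bf1 hθ) κ hκ

/-- **UNCONDITIONAL (A)₂ for the census curve `460944bn1` — ZERO hypotheses, ZERO named facts** (capitulation row; `2`-torsion cubic field
`ℚ(θ)`, `θ³ + (-3)θ² + (0)θ + (-194) = 0`, `d = -115236` < 0, TWO primes above `2` or even `h`). Coates–Sujatha's statement (A) at `p = 2`:
for every cyclotomic `ℤ₂`-extension of `ℚ` the dual fine Selmer group over `ℚ_∞` is finitely generated over `ℤ₂` (`∃ γ D` currency). KERNEL: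
`classicalMu_two_460944bn1` (μ₂(ℚ(θ)_cyc) = 0, GEN 5–7 certificates + Fukuda) ⟹ cruxlead-19573-w2's ℓ = 2 ascent to the totally complex
`ℚ(E[2]) = ℚ(θ, √disc)` and guarded kernel Lim 3.5@2 (`TotallyComplexMu.conjA_two_cubicModel_of_classicalMu_of_discr_neg`, p728213).
UPGRADES `conjA_two_460944bn1 hLim2`. BSD for `460944bn1` is NOT proved by this. [cite: CoatesSujatha2005, Conj. A and Thm. 3.4]
[cite: Iwasawa1973MuInvariants, Thm. 2 and Thm. 3] [cite: Fukuda1994, Thm. 1 (1), p. 264] -/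
theorem conjA_two_460944bn1' (κ : ZpExtension ℚ 2) (hκ : κ.IsCyclotomic) :
    haveI := isElliptic_460944bn1'
    ∃ (γ : absoluteGaloisGroup ℚ) (D : (⟨0, ((0 : ℤ) : ℚ), 0, ((-5770251 : ℤ) : ℚ), ((-5454740502 : ℤ) : ℚ)⟩ : WeierstrassCurve ℚ).FineSelmerDualData κ γ),
      Module.Finite ℤ_[2] (RestrictScalars ℤ_[2] (IwasawaAlgebra 2) D.X) := by
  haveI := isElliptic_460944bn1'
  obtain ⟨θ, hθ⟩ : ∃ θ : AlgebraicClosure ℚ, aeval θ (Cubic.toPoly ⟨1, ((-3 : ℤ) : ℚ), ((0 : ℤ) : ℚ), ((-194 : ℤ) : ℚ)⟩) = 0 :=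
    IsAlgClosed.exists_aeval_eq_zero _ _ (by rw [Cubic.degree_of_a_ne_zero one_ne_zero]; norm_num)
  have hθ' : θ ^ 3 + (-3 : AlgebraicClosure ℚ) * θ ^ 2 + (0 : AlgebraicClosure ℚ) * θ + (-194 : AlgebraicClosure ℚ) = 0 := by
    have := hθ
    simp only [Cubic.toPoly, map_one, one_mul, aeval_add, aeval_mul, aeval_C, aeval_X_pow, aeval_X,
      eq_ratCast, Rat.cast_intCast] at this
    push_cast at this
    linear_combination this
  set β : AlgebraicClosure ℚ := algebraMap ℚ (AlgebraicClosure ℚ) (-293 : ℚ) +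
      algebraMap ℚ (AlgebraicClosure ℚ) (182 : ℚ) * θ + algebraMap ℚ (AlgebraicClosure ℚ) (37 : ℚ) * θ ^ 2 with hβdef
  have hβ : aeval β (Cubic.toPoly ⟨1, ((0 : ℤ) : ℚ), ((-5770251 : ℤ) : ℚ), ((-5454740502 : ℤ) : ℚ)⟩) = 0 := by
    simp only [Cubic.toPoly, map_one, one_mul, aeval_add, aeval_mul, aeval_C, aeval_X_pow, aeval_X, eq_ratCast,
      Rat.cast_intCast]
    rw [hβdef]
    simp only [eq_ratCast]
    push_cast
    linear_combination ((19532014 : AlgebraicClosure ℚ) + (5171712 : AlgebraicClosure ℚ) * θ + (899433 : AlgebraicClosure ℚ) * θ ^ 2 + (50653 : AlgebraicClosure ℚ) * θ ^ 3) * hθ'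
  have hadj : IntermediateField.adjoin ℚ {β} = IntermediateField.adjoin ℚ {θ} := by
    apply le_antisymm
    · rw [IntermediateField.adjoin_simple_le_iff, hβdef]
      have hθmem := IntermediateField.mem_adjoin_simple_self ℚ θ
      exact add_mem (add_mem (algebraMap_mem _ _) (mul_mem (algebraMap_mem _ _) hθmem))
        (mul_mem (algebraMap_mem _ _) (pow_mem hθmem 2))
    · rw [IntermediateField.adjoin_simple_le_iff]
      have hθeq : θ = algebraMap ℚ (AlgebraicClosure ℚ) (8229483/322102 : ℚ) +
          algebraMap ℚ (AlgebraicClosure ℚ) (21389/1932612 : ℚ) * β +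
          algebraMap ℚ (AlgebraicClosure ℚ) (-37/5797836 : ℚ) * β ^ 2 := by
        rw [hβdef]; simp only [eq_ratCast]; push_cast
        linear_combination (((650275 : AlgebraicClosure ℚ) / 5797836) + ((50653 : AlgebraicClosure ℚ) / 5797836) * θ) * hθ'
      rw [hθeq]
      have hβmem := IntermediateField.mem_adjoin_simple_self ℚ β
      exact add_mem (add_mem (algebraMap_mem _ _) (mul_mem (algebraMap_mem _ _) hβmem))
        (mul_mem (algebraMap_mem _ _) (pow_mem hβmem 2))
  have h3 : Module.finrank ℚ (IntermediateField.adjoin ℚ {β}) = 3 := by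
    rw [hadj]; exact finrank_adjoin_eq_three_of_irreducible irreducible_cubic_d115236n hθ
  exact TotallyComplexMu.conjA_two_cubicModel_of_classicalMu_of_discr_neg (0) (-5770251) (-5454740502)
    (irreducible_cubic_of_finrank_adjoin_eq_three hβ h3) (by simp only [Cubic.discr]; norm_num) hβ
    (by rw [hadj]; exact classicalMu_two_460944bn1 hθ) κ hκ

end Summit.BirchSwinnertonDyer.BirchSwinnertonDyer.Theorems.AddKatoTwo

end
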